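import Summits.QuantumFields.YangMills.Theorems.DiagonalMirrorRPRTwoShiftIdentitiesAt

/-!
# Crux `WeakCouplingHypercubicLimitRP` (stmt-QuantumFields-27398), door B, R1-side, item (ii) — INHABITATION OF THE REGIME:
# every pinned probe of sub-torus box size, RE-SHIFTED to `n_k = ⌊side_k/16⌋ + 1`, carries the two-shift identities

Helper file (`--supports stmt-QuantumFields-27398 --as helper`) of the hand `hand-10604-wilsonDiagModel-2` g3 (docket director-ym g24, O4 WORD 50 (2) / 51 (1):
«an interface whose regime fields cannot be met by the probe of record makes `twoShiftProbesAt` VACUOUSLY parametric — this check happens BEFORE the bytes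
freeze»; ✓ `twoShiftIdentitiesAt` (…TwoShiftIdentitiesAt) carries three displayed arithmetic hypotheses on `(n_k, T_k, side_k)`; here they are DISCHARGED by a
choice of the shift).  It closes nothing by itself.

WHAT.
* `PinnedProbe.reshift P hT` — the SAME probe functionals `Y_k`, boxes `T_k`, bounds `B_k` (✓ `…TwoShiftProbesPinnedDefs.PinnedProbe`), with the shift
  re-chosen as `n_k := side_k / 16 + 1` (`ℕ`-division); admissible (`room`) as soon as `16 T_k + 48 ≤ side_k` eventually — in particular for every probe of
  bounded PHYSICAL box size (`a_k T_k ≤ R`, `PinnedProbe.eventually_box_le_side_of_bounded`, since `a_k side_k → ∞`);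
* `reshift_n_ne_zero`, `reshift_side_le` (`side_k ≤ 16 n_k` for ALL `k`), `reshift_regime` (`48 n_k + 16 (2T_k + 1) ≤ 5 side_k` eventually);
* ★ `twoShiftIdentitiesReshift P hT : TwoShiftIdentities r sch hβ (P.reshift hT)` — hand-3's contract (✓ `…DiagonalMirrorRPRTwoShiftProbesAt`) inhabited
  with NO residual hypothesis beyond the sub-torus box size, so `twoShiftProbesAt (twoShiftIdentitiesReshift …) C hC hc` is the sandwich instance for a
  genuine probe family, parametric only in the displayed coupling letter `hc : SlowCoupled _` and `C ≥ 0`.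

HONEST FRAMING: arithmetic on the probe's shift; nothing about Wilson's measure; K1, K2, `SlowCoupled`, `RPSpectral`, R2♭ OPEN; D1′, ⟨27398⟩ (0∕2), S6i,
⟨10604⟩ OPEN; the Yang–Mills mass gap is NOT proved here or anywhere in the tree.  Two `def`s, no instance, no notation, `autoImplicit false`.

References: Osterwalder–Seiler, Ann. Phys. 110 (1978) §2–3 (transfer-matrix two-point functions; the shift is a free parameter of the probe).
-/

set_option autoImplicit false

noncomputable section

open MeasureTheory Filter Topology
open Literature.MathematicalPhysics.QuantumLattice Literature.MathematicalPhysics.QuantumFieldTheory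
open Summit.QuantumFields.YangMills.Cruxes.DiagonalMirrorRPR.SignTwistedDiagonalTrace (tendsto_a_mul_side')

namespace Summit.QuantumFields.YangMills.Cruxes.DiagonalMirrorRPR.SpectralTransfer

variable {G : Type} [Group G] [TopologicalSpace G] [IsTopologicalGroup G] [CompactSpace G]
  [MeasurableSpace G] [BorelSpace G] (r : LatticeRep G) {sch : SpeciesScheme (YMSpecies G)}

/-- **Re-shifting a pinned probe to `n_k = side_k/16 + 1`.**  Same functionals, boxes and bounds; the room `2(2T_k + 2n_k + 3) ≤ L_k` holds eventually
once `16 T_k + 48 ≤ side_k` eventually. -/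
def PinnedProbe.reshift (P : PinnedProbe sch) (hT : ∀ᶠ k in atTop, 16 * P.T k + 48 ≤ sch.side k) : PinnedProbe sch where
  Y := P.Y
  T := P.T
  B := P.B
  n := fun k => sch.side k / 16 + 1
  measurable := P.measurable
  bdd := P.bdd
  boxLocal := P.boxLocal
  room := by
    filter_upwards [hT] with k hk
    have hs : sch.side k = 2 * sch.L k + 1 := rfl
    omega

omit [TopologicalSpace G] [IsTopologicalGroup G] [CompactSpace G] [BorelSpace G] in
/-- The re-shifted probe has the same functionals. -/
theorem PinnedProbe.reshift_Y (P : PinnedProbe sch) (hT : ∀ᶠ k in atTop, 16 * P.T k + 48 ≤ sch.side k) : (P.reshift hT).Y = P.Y := rfl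

omit [TopologicalSpace G] [IsTopologicalGroup G] [CompactSpace G] [BorelSpace G] in
/-- The re-shifted probe has the same boxes. -/
theorem PinnedProbe.reshift_T (P : PinnedProbe sch) (hT : ∀ᶠ k in atTop, 16 * P.T k + 48 ≤ sch.side k) : (P.reshift hT).T = P.T := rfl

omit [TopologicalSpace G] [IsTopologicalGroup G] [CompactSpace G] [BorelSpace G] in
/-- The shift of the re-shifted probe: `n_k = side_k / 16 + 1`. -/
theorem PinnedProbe.reshift_n (P : PinnedProbe sch) (hT : ∀ᶠ k in atTop, 16 * P.T k + 48 ≤ sch.side k) (k : ℕ) :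
    (P.reshift hT).n k = sch.side k / 16 + 1 := rfl

omit [TopologicalSpace G] [IsTopologicalGroup G] [CompactSpace G] [BorelSpace G] in
/-- The shift is never zero. -/
theorem PinnedProbe.reshift_n_ne_zero (P : PinnedProbe sch) (hT : ∀ᶠ k in atTop, 16 * P.T k + 48 ≤ sch.side k) (k : ℕ) :
    (P.reshift hT).n k ≠ 0 :=
  Nat.succ_ne_zero _

omit [TopologicalSpace G] [IsTopologicalGroup G] [CompactSpace G] [BorelSpace G] in
/-- `side_k ≤ 16 n_k` for every `k`. -/
theorem PinnedProbe.reshift_side_le (P : PinnedProbe sch) (hT : ∀ᶠ k in atTop, 16 * P.T k + 48 ≤ sch.side k) (k : ℕ) :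
    (sch.side k : ℝ) ≤ 16 * ((P.reshift hT).n k : ℕ) := by
  have h : sch.side k ≤ 16 * (sch.side k / 16 + 1) := by omega
  have h' : ((sch.side k : ℕ) : ℝ) ≤ ((16 * (sch.side k / 16 + 1) : ℕ) : ℝ) := by exact_mod_cast h
  simpa [PinnedProbe.reshift_n] using h'

omit [TopologicalSpace G] [IsTopologicalGroup G] [CompactSpace G] [BorelSpace G] in
/-- The regime of `twoShiftIdentitiesAt`: `48 n_k + 16 (2T_k + 1) ≤ 5 side_k` eventually. -/
theorem PinnedProbe.reshift_regime (P : PinnedProbe sch) (hT : ∀ᶠ k in atTop, 16 * P.T k + 48 ≤ sch.side k) :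
    ∀ᶠ k in atTop, 48 * (P.reshift hT).n k + 16 * (2 * (P.reshift hT).T k + 1) ≤ 5 * sch.side k := by
  filter_upwards [hT] with k hk
  rw [PinnedProbe.reshift_n, PinnedProbe.reshift_T]
  omega

omit [TopologicalSpace G] [IsTopologicalGroup G] [CompactSpace G] [BorelSpace G] in
/-- **Boxes of bounded physical size are sub-torus**: `a_k T_k ≤ R` eventually implies `16 T_k + 48 ≤ side_k` eventually (`a_k side_k → ∞`, `a_k → 0`). -/
theorem PinnedProbe.eventually_box_le_side_of_bounded (P : PinnedProbe sch) {R : ℝ} (hR : ∀ᶠ k in atTop, sch.a k * P.T k ≤ R) :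
    ∀ᶠ k in atTop, 16 * P.T k + 48 ≤ sch.side k := by
  have ha1 : ∀ᶠ k in atTop, sch.a k ≤ 1 := ((tendsto_order.1 sch.tendsto_a).2 1 one_pos).mono fun k hk => hk.le
  filter_upwards [hR, ha1, (tendsto_a_mul_side' sch).eventually_ge_atTop (16 * R + 48)] with k hk hk1 hk2
  have ha := sch.a_pos k
  have h1 : sch.a k * (16 * (P.T k : ℝ) + 48) ≤ sch.a k * sch.side k := by
    calc sch.a k * (16 * (P.T k : ℝ) + 48) = 16 * (sch.a k * P.T k) + 48 * sch.a k := by ring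
      _ ≤ 16 * R + 48 * 1 := by nlinarith
      _ ≤ sch.a k * sch.side k := by linarith
  have h2 : (16 * (P.T k : ℝ) + 48) ≤ sch.side k := le_of_mul_le_mul_left h1 ha
  exact_mod_cast h2

/-- ★ **The two-shift identities of a re-shifted pinned probe** — hand-3's contract `TwoShiftIdentities` inhabited for every probe family of sub-torus box
size, with no residual arithmetic hypothesis. -/
def twoShiftIdentitiesReshift (hβ : ∀ k, 0 ≤ sch.β k) (P : PinnedProbe sch) (hT : ∀ᶠ k in atTop, 16 * P.T k + 48 ≤ sch.side k) :
    TwoShiftIdentities r sch hβ (P.reshift hT) :=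
  twoShiftIdentitiesAt r sch hβ (P.reshift hT) (P.reshift_n_ne_zero hT) (Eventually.of_forall (P.reshift_side_le hT)) (P.reshift_regime hT)

/-- The same for a probe of bounded physical box size `a_k T_k ≤ R`. -/
def twoShiftIdentitiesOfBoundedBox (hβ : ∀ k, 0 ≤ sch.β k) (P : PinnedProbe sch) {R : ℝ} (hR : ∀ᶠ k in atTop, sch.a k * P.T k ≤ R) :
    TwoShiftIdentities r sch hβ (P.reshift (P.eventually_box_le_side_of_bounded hR)) :=
  twoShiftIdentitiesReshift r hβ P (P.eventually_box_le_side_of_bounded hR)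

end Summit.QuantumFields.YangMills.Cruxes.DiagonalMirrorRPR.SpectralTransfer

end
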